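import Summits.BirchSwinnertonDyer.BirchSwinnertonDyer.Theorems.ShaPrimaryTransferFiniteShaComponentTransferSelmerCubicE2KSVRow
import HarnessLib

/-!
# BirchSwinnertonDyer — SEL2CUBIC door for the `checkE2KSV` census rows: the `K`-free row shapes

HONEST FRAMING: route `ShaPrimaryTransfer`, seat `bsd-line-spt-p1` (g30), `--supports` item T =
`FiniteShaComponentTransfer` (stmt-22356), UNCHANGED (conjecture-grade at corank ≥ 2). BSD in rank ≥ 2 is
NOT proved by any of this. THEOREMS ONLY.

The wrappers of `sha_door_of_checkE2KSV` (`…SelmerCubicE2KSVRow`) in the exact argument shapes of the census rows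
`rank_eq_of_certsE2KSV{,_scaled,_complSq,_plain}` (`Rank2Observatory2DescClSubCurveCertE2VRows`), with the kill
hypothesis `hk` in RESIDUE form (assembled by `killResidueE2_nil` / `killResidueE2_cons` of `…SelmerCubicE2KRows` from
`killResidue_of_<shape> … (by decide +kernel)`, the census certificates UNCHANGED): every such row becomes an
unconditional `t₂(E) = 0 ∧ rank E(ℚ) = r` door by swapping theorem names.
[cite: Cassels1991LecturesEllipticCurves, §15] [cite: SilvermanAEC2009, Thm. X.4.2, Rem. X.4.1]
[cite: CremonaAlgorithms1997, §3.6]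
-/

-- single-conjunct summit: `Summit.BirchSwinnertonDyer.BirchSwinnertonDyer.…` repeats the name by design
set_option linter.dupNamespace false

noncomputable section

open scoped Classical NumberField nonZeroDivisors

open Literature.NumberTheory.NumberFields Literature.NumberTheory.EllipticCurves
  Literature.NumberTheory.GaloisRepresentations Polynomial Module NumberField IsDedekindDomain Ideal
open WeierstrassCurve WeierstrassCurve.Affine

namespace Summit.BirchSwinnertonDyer.BirchSwinnertonDyer.Theorems.ShaPrimaryTransferSelmerCubicCover

open Summit.BirchSwinnertonDyer.BirchSwinnertonDyer.Rank2Observatory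
open Summit.BirchSwinnertonDyer.BirchSwinnertonDyer.Rank2Observatory.TwoDescCubic
open Summit.BirchSwinnertonDyer.BirchSwinnertonDyer.Rank2Observatory.TwoDescCl
open Summit.BirchSwinnertonDyer.BirchSwinnertonDyer.Rank2Observatory.TwoDescCl.ClFieldCert
open Summit.BirchSwinnertonDyer.BirchSwinnertonDyer.Rank2Observatory.TwoDescKill
open Summit.BirchSwinnertonDyer.BirchSwinnertonDyer.Theorems.ShaPrimaryTransferSelmerCubicKill

/-! ## `K`-free wrappers (the census rows' shapes) -/

section Rows

/-- **`K`-free door shape** (model `(0, A, 0, B, C)` read over `ℚ` from `ℤ`), in the exact shape of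
`rank_eq_of_certsE2KSV` (`hk` in residue form): the row's arguments unchanged, the theorem name swapped.
[cite: Cassels1991LecturesEllipticCurves, §15] [cite: CremonaAlgorithms1997, §3.6] -/
theorem sha_door_of_certsE2KSV (r : ℕ) (F : ClFieldCertE2) (cc : ClCurveCertE2) (ks : List ClKillE2)
    (sv : List (List ℕ)) (h2 : F.check2 = true)
    (hpr : F.fe.primeListE.Forall Nat.Prime) (hc : checkE2KSV F cc r ks sv = true)
    (hk : ∀ k ∈ ks, k.p.Prime ∧ ∃ N : ℕ, ∀ v : ℤ × ℤ × ℤ × ℤ,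
      ¬ ((k.p : ℤ) ∣ v.1 ∧ (k.p : ℤ) ∣ v.2.1 ∧ (k.p : ℤ) ∣ v.2.2.1 ∧ (k.p : ℤ) ∣ v.2.2.2) →
      (k.p : ℤ) ^ N ∣ (killQ F.fe.base.a F.fe.base.b F.fe.base.c (k.z F cc) cc.Xt.2.1 cc.Xt.2.2 v).1 →
      (k.p : ℤ) ^ N ∣ (killQ F.fe.base.a F.fe.base.b F.fe.base.c (k.z F cc) cc.Xt.2.1 cc.Xt.2.2 v).2 → False)
    (hlow : r ≤ (((⟨0, cc.A, 0, cc.B, cc.C⟩ : WeierstrassCurve ℤ)).map (Int.castRingHom ℚ)).mordellWeilRank) :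
    (((⟨0, cc.A, 0, cc.B, cc.C⟩ : WeierstrassCurve ℤ)).map (Int.castRingHom ℚ)).shaCorank 2 = 0 ∧
      AddCommGroup.primaryComponent (((⟨0, cc.A, 0, cc.B, cc.C⟩ : WeierstrassCurve ℤ)).map (Int.castRingHom ℚ)).sha 2 = ⊥ ∧
        (((⟨0, cc.A, 0, cc.B, cc.C⟩ : WeierstrassCurve ℤ)).map (Int.castRingHom ℚ)).mordellWeilRank = r := by
  haveI : Fact (Irreducible (MonicCubic.polyQ F.fe.base.a F.fe.base.b F.fe.base.c)) :=
    ⟨F.fe.base.irreducible_of_field (F.fe.checkField_of_checkE (F.checkE_of_check2 h2))⟩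
  exact sha_door_map_of_door (fun h => sha_door_of_checkE2KSV (K := CubicField F.fe.base.a F.fe.base.b F.fe.base.c) r F
      (CubicField.aeval_root _ _ _) (CubicField.finrank_eq _ _ _) h2 hpr cc ks sv hc hk h) hlow

/-- `Δ ≠ 0` is the first clause of `checkE2KSV`. [folklore] -/
theorem deltaShort_ne_of_checkE2KSV {r : ℕ} {F : ClFieldCertE2} {cc : ClCurveCertE2} {ks : List ClKillE2}
    {sv : List (List ℕ)} (hc : checkE2KSV F cc r ks sv = true) : deltaShort cc.A cc.B cc.C ≠ 0 := by
  simp only [checkE2KSV, Bool.and_eq_true, decide_eq_true_eq] at hc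
  exact hc.1.1.1.1.1.1.1.1.1.1.1.1.1.1.1.1.1.1.1

/-- **`t₂(E) = 0 ∧ rank E(ℚ) = r` for the ORIGINAL model** `(a₁, a₂, a₃, a₄, a₆)` when the records certify its
completed-square model RESCALED by `d` (`t₂` and the rank are invariant under the change of variables), in the shape
of `rank_eq_of_certsE2KSV_scaled`. [cite: CremonaAlgorithms1997, §3.6] [cite: SilvermanAEC2009, III.3.1(b), Thm. X.4.2] -/
theorem shaCorank_two_eq_zero_of_certsE2KSV_scaled (r : ℕ) (F : ClFieldCertE2) (cc : ClCurveCertE2) (ks : List ClKillE2)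
    (sv : List (List ℕ)) (h2 : F.check2 = true)
    (hpr : F.fe.primeListE.Forall Nat.Prime) (hc : checkE2KSV F cc r ks sv = true)
    (hk : ∀ k ∈ ks, k.p.Prime ∧ ∃ N : ℕ, ∀ v : ℤ × ℤ × ℤ × ℤ,
      ¬ ((k.p : ℤ) ∣ v.1 ∧ (k.p : ℤ) ∣ v.2.1 ∧ (k.p : ℤ) ∣ v.2.2.1 ∧ (k.p : ℤ) ∣ v.2.2.2) →
      (k.p : ℤ) ^ N ∣ (killQ F.fe.base.a F.fe.base.b F.fe.base.c (k.z F cc) cc.Xt.2.1 cc.Xt.2.2 v).1 →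
      (k.p : ℤ) ^ N ∣ (killQ F.fe.base.a F.fe.base.b F.fe.base.c (k.z F cc) cc.Xt.2.1 cc.Xt.2.2 v).2 → False) (a₁ a₂ a₃ a₄ a₆ d : ℤ)
    (hd : d ≠ 0)
    (hABC : cc.A = d ^ 2 * (a₁ ^ 2 + 4 * a₂) ∧ cc.B = d ^ 4 * (8 * (a₁ * a₃ + 2 * a₄)) ∧
      cc.C = d ^ 6 * (16 * (a₃ ^ 2 + 4 * a₆)))
    (hlow : r ≤ (((⟨a₁, a₂, a₃, a₄, a₆⟩ : WeierstrassCurve ℤ)).map (Int.castRingHom ℚ)).mordellWeilRank) :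
    (((⟨a₁, a₂, a₃, a₄, a₆⟩ : WeierstrassCurve ℤ)).map (Int.castRingHom ℚ)).shaCorank 2 = 0 ∧
      (((⟨a₁, a₂, a₃, a₄, a₆⟩ : WeierstrassCurve ℤ)).map (Int.castRingHom ℚ)).mordellWeilRank = r := by
  haveI : Fact (Irreducible (MonicCubic.polyQ F.fe.base.a F.fe.base.b F.fe.base.c)) :=
    ⟨F.fe.base.irreducible_of_field (F.fe.checkField_of_checkE (F.checkE_of_check2 h2))⟩
  exact shaCorank_two_transport_scaled a₁ a₂ a₃ a₄ a₆ d hd hABC (deltaShort_ne_of_checkE2KSV hc)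
    (fun h => sha_door_of_checkE2KSV (K := CubicField F.fe.base.a F.fe.base.b F.fe.base.c) r F
      (CubicField.aeval_root _ _ _) (CubicField.finrank_eq _ _ _) h2 hpr cc ks sv hc hk h) hlow

/-- The plain completed-square shape (`d = 1`), in the shape of `rank_eq_of_certsE2KSV_complSq`.
[cite: CremonaAlgorithms1997, §3.6] [cite: SilvermanAEC2009, Thm. X.4.2] -/
theorem shaCorank_two_eq_zero_of_certsE2KSV_complSq (r : ℕ) (F : ClFieldCertE2) (cc : ClCurveCertE2) (ks : List ClKillE2)
    (sv : List (List ℕ)) (h2 : F.check2 = true)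
    (hpr : F.fe.primeListE.Forall Nat.Prime) (hc : checkE2KSV F cc r ks sv = true)
    (hk : ∀ k ∈ ks, k.p.Prime ∧ ∃ N : ℕ, ∀ v : ℤ × ℤ × ℤ × ℤ,
      ¬ ((k.p : ℤ) ∣ v.1 ∧ (k.p : ℤ) ∣ v.2.1 ∧ (k.p : ℤ) ∣ v.2.2.1 ∧ (k.p : ℤ) ∣ v.2.2.2) →
      (k.p : ℤ) ^ N ∣ (killQ F.fe.base.a F.fe.base.b F.fe.base.c (k.z F cc) cc.Xt.2.1 cc.Xt.2.2 v).1 →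
      (k.p : ℤ) ^ N ∣ (killQ F.fe.base.a F.fe.base.b F.fe.base.c (k.z F cc) cc.Xt.2.1 cc.Xt.2.2 v).2 → False) (a₁ a₂ a₃ a₄ a₆ : ℤ)
    (hABC : cc.A = a₁ ^ 2 + 4 * a₂ ∧ cc.B = 8 * (a₁ * a₃ + 2 * a₄) ∧ cc.C = 16 * (a₃ ^ 2 + 4 * a₆))
    (hlow : r ≤ (((⟨a₁, a₂, a₃, a₄, a₆⟩ : WeierstrassCurve ℤ)).map (Int.castRingHom ℚ)).mordellWeilRank) :
    (((⟨a₁, a₂, a₃, a₄, a₆⟩ : WeierstrassCurve ℤ)).map (Int.castRingHom ℚ)).shaCorank 2 = 0 ∧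
      (((⟨a₁, a₂, a₃, a₄, a₆⟩ : WeierstrassCurve ℤ)).map (Int.castRingHom ℚ)).mordellWeilRank = r := by
  haveI : Fact (Irreducible (MonicCubic.polyQ F.fe.base.a F.fe.base.b F.fe.base.c)) :=
    ⟨F.fe.base.irreducible_of_field (F.fe.checkField_of_checkE (F.checkE_of_check2 h2))⟩
  exact shaCorank_two_transport_complSq a₁ a₂ a₃ a₄ a₆ hABC (deltaShort_ne_of_checkE2KSV hc)
    (fun h => sha_door_of_checkE2KSV (K := CubicField F.fe.base.a F.fe.base.b F.fe.base.c) r F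
      (CubicField.aeval_root _ _ _) (CubicField.finrank_eq _ _ _) h2 hpr cc ks sv hc hk h) hlow

/-- Door plumbing for a curve already given by a plain model `y² = x³ + a₂x² + a₄x + a₆` (`a₁ = a₃ = 0`), in
the shape of `rank_eq_of_certsE2KSV_plain`. [cite: Cassels1991LecturesEllipticCurves, §15] -/
theorem sha_door_of_certsE2KSV_plain (r : ℕ) (F : ClFieldCertE2) (cc : ClCurveCertE2) (ks : List ClKillE2)
    (sv : List (List ℕ)) (h2 : F.check2 = true)
    (hpr : F.fe.primeListE.Forall Nat.Prime) (hc : checkE2KSV F cc r ks sv = true)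
    (hk : ∀ k ∈ ks, k.p.Prime ∧ ∃ N : ℕ, ∀ v : ℤ × ℤ × ℤ × ℤ,
      ¬ ((k.p : ℤ) ∣ v.1 ∧ (k.p : ℤ) ∣ v.2.1 ∧ (k.p : ℤ) ∣ v.2.2.1 ∧ (k.p : ℤ) ∣ v.2.2.2) →
      (k.p : ℤ) ^ N ∣ (killQ F.fe.base.a F.fe.base.b F.fe.base.c (k.z F cc) cc.Xt.2.1 cc.Xt.2.2 v).1 →
      (k.p : ℤ) ^ N ∣ (killQ F.fe.base.a F.fe.base.b F.fe.base.c (k.z F cc) cc.Xt.2.1 cc.Xt.2.2 v).2 → False) (a₂ a₄ a₆ : ℤ)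
    (hABC : cc.A = a₂ ∧ cc.B = a₄ ∧ cc.C = a₆)
    (hlow : r ≤ (((⟨0, a₂, 0, a₄, a₆⟩ : WeierstrassCurve ℤ)).map (Int.castRingHom ℚ)).mordellWeilRank) :
    (((⟨0, a₂, 0, a₄, a₆⟩ : WeierstrassCurve ℤ)).map (Int.castRingHom ℚ)).shaCorank 2 = 0 ∧
      AddCommGroup.primaryComponent ((((⟨0, a₂, 0, a₄, a₆⟩ : WeierstrassCurve ℤ)).map (Int.castRingHom ℚ))).sha 2
          = ⊥ ∧
        (((⟨0, a₂, 0, a₄, a₆⟩ : WeierstrassCurve ℤ)).map (Int.castRingHom ℚ)).mordellWeilRank = r := by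
  haveI : Fact (Irreducible (MonicCubic.polyQ F.fe.base.a F.fe.base.b F.fe.base.c)) :=
    ⟨F.fe.base.irreducible_of_field (F.fe.checkField_of_checkE (F.checkE_of_check2 h2))⟩
  exact sha_door_transport_plain a₂ a₄ a₆ hABC
    (fun h => sha_door_of_checkE2KSV (K := CubicField F.fe.base.a F.fe.base.b F.fe.base.c) r F
      (CubicField.aeval_root _ _ _) (CubicField.finrank_eq _ _ _) h2 hpr cc ks sv hc hk h) hlow

end Rows

end Summit.BirchSwinnertonDyer.BirchSwinnertonDyer.Theorems.ShaPrimaryTransferSelmerCubicCover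

end
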